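import Summits.KontsevichZagierPeriods.KontsevichZagierPeriods.Theorems.LinRedNormalFormArrangementNormalFormSeparateThreePiece
import Summits.KontsevichZagierPeriods.KontsevichZagierPeriods.Theorems.LinRedNormalFormArrangementNormalFormSeparateHighCuts

/-!
# The grid dissection of the 3-d engine (stub `stub_separateThreeZero`, part `Grid`)

(Line `janus-bands`, crux `ArrangementNormalForm`, stub `stub_separateThreeZero` — fibre-free
separation over a bounded rational polytope in `ℝ³`, `JJ 3 0 → closure (GG 2 1 0)`; part `Grid`.)

`SepThree.grid` (registered as `separateThree_grid`): the piece theorem `SepThree.piece` without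
its hypothesis `hsep` (at most one special point in the closed cell). The SPECIAL POINTS of a
literal arrangement datum in engine coordinates with respect to a set `K₀ ⊇` the closed cell
(singleton contacts `{L_j = 0} ∩ {L_{j'} = 0} ∩ K₀` of two non-proportional active `y`-letters)
form a finite set; cutting the cell (rule 1a, `SepHigh.cuts`) along a rational coordinate GRID
of mesh smaller than the minimal distance of two special points leaves literal sub-cells
(sub-domains, same letters, same `K₀`, thin contacts inherited) whose closures contain at most
one special point each — two of them would be separated strictly by a grid plane, which has a
constant sign on the sub-cell — so that `SepThree.piece` applies to every sub-cell.
-/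

noncomputable section

open Set MeasureTheory Filter Topology

namespace Summit.KontsevichZagierPeriods.ArrangementNormalForm.JanusBands

open Literature.NumberTheory.Transcendental

namespace SepThree

open SeparatePos MvPolynomial

/-- A grid point strictly between two reals more than one mesh apart. -/
theorem exists_grid_btwn {u v R h : ℝ} (hh : 0 < h) (hu : -R ≤ u) (huv : u + h < v) :
    ∃ i : ℕ, u < -R + i * h ∧ -R + i * h < v ∧ (i : ℝ) ≤ (u + R) / h + 1 := by
  have h0 : 0 ≤ (u + R) / h := div_nonneg (by linarith) hh.le
  refine ⟨⌊(u + R) / h⌋₊ + 1, ?_, ?_, ?_⟩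
  · have h1 := Nat.lt_floor_add_one ((u + R) / h)
    rw [div_lt_iff₀ hh] at h1
    push_cast
    linarith
  · have h1 := Nat.floor_le h0
    rw [le_div_iff₀ hh] at h1
    push_cast
    nlinarith
  · push_cast
    linarith [Nat.floor_le h0]

/-- The literal value of the grid form `(e_l, c)`. -/
theorem grid_form_val (l : Fin (2 + 1)) (c : ℚ) (z : Fin (2 + 1 + 0) → ℝ) :
    (∑ i, (((Pi.single l (1 : ℚ), c) : (Fin (2 + 1) → ℚ) × ℚ).1 i : ℝ) * z (Fin.castAdd 0 i) +
      ((((Pi.single l (1 : ℚ), c) : (Fin (2 + 1) → ℚ) × ℚ).2 : ℚ) : ℝ)) =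
      z (Fin.castAdd 0 l) + c := by
  have h1 : ∀ x : Fin (2 + 1), (((Pi.single l (1 : ℚ) : Fin (2 + 1) → ℚ) x : ℚ) : ℝ) *
      z (Fin.castAdd 0 x) = if x = l then z (Fin.castAdd 0 l) else 0 := fun x => by
    rw [Pi.single_apply]
    split_ifs with h
    · rw [h]; simp
    · simp
  simp only [h1, Finset.sum_ite_eq', Finset.mem_univ, if_true]

/-- Strict signs on a cell are weak signs on its closure. -/
theorem nonneg_on_closure {f : (Fin (2 + 1 + 0) → ℝ) → ℝ} (hf : Continuous f)
    {D : Set (Fin (2 + 1 + 0) → ℝ)} (h : ∀ z ∈ D, 0 < f z) : ∀ z ∈ closure D, 0 ≤ f z :=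
  fun _ hz => closure_minimal (fun z hz => show z ∈ {z | 0 ≤ f z} from (h z hz).le)
    (isClosed_le continuous_const hf) hz

/-- **The grid dissection**: the piece theorem `SepThree.piece` without the hypothesis `hsep`;
see the module docstring. -/
theorem grid
    (hHI₃ : ∀ (b k m m' n : ℕ) (s : KZ.IntegralRep (b + 1 + k)) (M : Fin m' → (Fin (b + 1) → ℚ) × ℚ) (L : Fin m → (Fin b → ℚ) × ℚ) (e : Fin m → ℕ) (p : MvPolynomial (Fin (b + 1)) ℚ) (ℓ : (Fin b → ℚ) × ℚ) (a : Fin k → Option ((Fin (b + 1) → ℚ) × ℚ)) (lo hi : Fin k → Fin k ⊕ ((Fin (b + 1) → ℚ) × ℚ)) (hpole : n ≠ 0 → ∀ z ∈ s.domain, (z (Fin.castAdd k (Fin.last b)) - (∑ i, (ℓ.1 i : ℝ) * z (Fin.castAdd k (Fin.castSucc i)) + (ℓ.2 : ℝ))) ≠ 0) (hbd : Bornology.IsBounded s.domain) (hdom : s.domain = {z | (∀ j, 0 < ∑ i, ((M j).1 i : ℝ) * z (Fin.castAdd k i) + ((M j).2 : ℝ)) ∧ ∀ i, Sum.elim (fun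 j => z (Fin.natAdd (b + 1) j)) (fun c => ∑ i', (c.1 i' : ℝ) * z (Fin.castAdd k i') + (c.2 : ℝ)) (lo i) < z (Fin.natAdd (b + 1) i) ∧ z (Fin.natAdd (b + 1) i) < Sum.elim (fun j => z (Fin.natAdd (b + 1) j)) (fun c => ∑ i', (c.1 i' : ℝ) * z (Fin.castAdd k i') + (c.2 : ℝ)) (hi i)}) (hint : EqOn s.integrand (fun z => MvPolynomial.aeval (fun i => z (Fin.castAdd k i)) p / (∏ j, (∑ i, ((L j).1 i : ℝ) * z (Fin.castAdd k (Fin.castSucc i)) + ((L j).2 : ℝ)) ^ e j) * (1 / (z (Fin.castAdd k (Fin.last b)) - (∑ i, (ℓ.1 i : ℝ) * z (Fin.castAdd k (Fin.castSucc i)) + (ℓ.2 : ℝ))) ^ n) * ∏ i, (a i).elim 1 (fun c => 1 / (z (Fin.natAdd (b + 1) i) - (∑ i', (c.1 i' : ℝ) * z (Fin.castAdd k i') + (c.2 : ℝ))))) s.domain) (N : ℕ) (q : ℕ → MvPolynomial (Fin b) ℚ) (hq : ∀ z : Fin (b + 1 + k) → ℝ, MvPolynomial.aeval (fun i => z (Fin.castAdd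 k i)) p = ∑ i ∈ Finset.range N, MvPolynomial.aeval (fun i => z (Fin.castAdd k (Fin.castSucc i))) (q i) * (z (Fin.castAdd k (Fin.last b)) - (∑ i, (ℓ.1 i : ℝ) * z (Fin.castAdd k (Fin.castSucc i)) + (ℓ.2 : ℝ))) ^ i) (hb : b = 2) (hk : k = 0) (hR : ∀ z ∈ closure s.domain, (∃ j, e j ≠ 0 ∧ (∑ i, ((L j).1 i : ℝ) * z (Fin.castAdd k (Fin.castSucc i)) + ((L j).2 : ℝ)) = 0) → (n ≠ 0 ∧ z (Fin.castAdd k (Fin.last b)) = ∑ i, (ℓ.1 i : ℝ) * z (Fin.castAdd k (Fin.castSucc i)) + (ℓ.2 : ℝ)) ∨ (∃ z' ∈ closure s.domain, z' ≠ z ∧ ∀ i : Fin b, z' (Fin.castAdd k (Fin.castSucc i)) = z (Fin.castAdd k (Fin.castSucc i)))), ∀ i ∈ Finset.range N, IntegrableOn (fun z => MvPolynomial.aeval (fun i => z (Fin.castAdd k (Fin.castSucc i))) (q i) / (∏ j, (∑ i, ((L j).1 i : ℝ) * z (Fin.castAdd k (Fin.castSucc i)) + ((L j).2 : ℝ)) ^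 e j) * ((z (Fin.castAdd k (Fin.last b)) - (∑ i, (ℓ.1 i : ℝ) * z (Fin.castAdd k (Fin.castSucc i)) + (ℓ.2 : ℝ))) ^ i / (z (Fin.castAdd k (Fin.last b)) - (∑ i, (ℓ.1 i : ℝ) * z (Fin.castAdd k (Fin.castSucc i)) + (ℓ.2 : ℝ))) ^ n) * ∏ i, (a i).elim 1 (fun c => 1 / (z (Fin.natAdd (b + 1) i) - (∑ i', (c.1 i' : ℝ) * z (Fin.castAdd k i') + (c.2 : ℝ))))) s.domain)
    {m m' : ℕ} (s : KZ.IntegralRep (2 + 1 + 0))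
    (M : Fin m' → (Fin (2 + 1) → ℚ) × ℚ) (L : Fin m → (Fin (2 + 1) → ℚ) × ℚ) (e : Fin m → ℕ)
    (p : MvPolynomial (Fin (2 + 1)) ℚ) (a : Fin 0 → Option ((Fin (2 + 1) → ℚ) × ℚ))
    (lo hi : Fin 0 → Fin 0 ⊕ ((Fin (2 + 1) → ℚ) × ℚ))
    (hbd : Bornology.IsBounded s.domain) (hdom : s.domain = gDom 2 0 m' M lo hi)
    (hint : EqOn s.integrand (fun z => MvPolynomial.aeval (fun i => z (Fin.castAdd 0 i)) p /
      (∏ j, affF 2 0 (L j) z ^ e j) * fib 2 0 a z) s.domain)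
    (hact : ∀ j, e j ≠ 0 → (L j).1 ≠ 0 → (L j).1 (Fin.last 2) ≠ 0)
    (hpole : ∀ j, (L j).1 (Fin.last 2) ≠ 0 → e j ≠ 0 → ∀ z ∈ s.domain, affF 2 0 (L j) z ≠ 0)
    (hrat : ∀ j j', (L j).1 (Fin.last 2) ≠ 0 → (L j').1 (Fin.last 2) ≠ 0 → e j ≠ 0 → e j' ≠ 0 →
      (L j').1 (Fin.last 2) • L j ≠ (L j).1 (Fin.last 2) • L j' → ∃ C : ℝ, ∀ z ∈ s.domain,
      |affF 2 0 (L j') z| ≤ C * |((L j).1 (Fin.last 2) : ℝ) * affF 2 0 (L j') z -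
        ((L j').1 (Fin.last 2) : ℝ) * affF 2 0 (L j) z|)
    (K₀ : Set (Fin (2 + 1 + 0) → ℝ)) (hK₀ : closure s.domain ⊆ K₀)
    (hthin : ∀ j, (L j).1 (Fin.last 2) ≠ 0 → e j ≠ 0 → ∃ P u : Fin (2 + 1 + 0) → ℝ, ∀ z ∈ K₀,
      affF 2 0 (L j) z = 0 → ∃ t : ℝ, z = P + t • u) :
    ∃ c ∈ AddSubgroup.closure (GGset 2 1 0), KZ.of s - c ∈ KZ.relations := by
  classical
  -- the special points: a finite set
  set spec : (Fin (2 + 1 + 0) → ℝ) → Prop := fun X => ∃ j j',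
    ((L j).1 (Fin.last 2) ≠ 0 ∧ e j ≠ 0) ∧ ((L j').1 (Fin.last 2) ≠ 0 ∧ e j' ≠ 0) ∧
    root 2 (L j) ≠ root 2 (L j') ∧
    {z | affF 2 0 (L j) z = 0} ∩ {z | affF 2 0 (L j') z = 0} ∩ K₀ = {X} with hspec
  have hfin : {X | spec X}.Finite := by
    refine (Set.finite_range (fun q : Fin m × Fin m =>
      if h : ∃ X, {z | affF 2 0 (L q.1) z = 0} ∩ {z | affF 2 0 (L q.2) z = 0} ∩ K₀ = {X}
      then h.choose else 0)).subset ?_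
    rintro X ⟨j, j', -, -, -, hX⟩
    have h : ∃ X, {z | affF 2 0 (L j) z = 0} ∩ {z | affF 2 0 (L j') z = 0} ∩ K₀ = {X} := ⟨X, hX⟩
    refine ⟨(j, j'), ?_⟩
    simp only [dif_pos h]
    have h1 : X ∈ {z | affF 2 0 (L j) z = 0} ∩ {z | affF 2 0 (L j') z = 0} ∩ K₀ := by
      rw [hX]; exact rfl
    rw [h.choose_spec] at h1
    exact (Set.mem_singleton_iff.1 h1).symm
  -- the minimal distance of two special points
  obtain ⟨δ, hδ, hδsep⟩ : ∃ δ > (0 : ℝ), ∀ X X', spec X → spec X' → X ≠ X' → δ ≤ dist X X' := by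
    set Pr : Set ((Fin (2 + 1 + 0) → ℝ) × (Fin (2 + 1 + 0) → ℝ)) :=
      {q | spec q.1 ∧ spec q.2 ∧ q.1 ≠ q.2} with hPr
    have hPrf : Pr.Finite := (hfin.prod hfin).subset fun q hq => ⟨hq.1, hq.2.1⟩
    by_cases hne : Pr.Nonempty
    · obtain ⟨q₀, hq₀, hminq⟩ := hPrf.exists_minimalFor (fun q => dist q.1 q.2) Pr hne
      refine ⟨dist q₀.1 q₀.2, dist_pos.2 hq₀.2.2, fun X X' hX hX' hne' => ?_⟩
      by_contra hlt
      push Not at hlt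
      have := hminq (show (X, X') ∈ Pr from ⟨hX, hX', hne'⟩) hlt.le
      exact absurd this (not_le.2 hlt)
    · exact ⟨1, one_pos, fun X X' hX hX' hne' => absurd ⟨(X, X'), hX, hX', hne'⟩ hne⟩
  obtain ⟨hq, hhq0, hhqδ⟩ := exists_rat_btwn hδ
  have hhq0' : (0 : ℝ) < hq := hhq0
  -- a priori bound and the grid
  obtain ⟨R₀, hR₀⟩ := hbd.closure.exists_norm_le
  obtain ⟨Rq, hRq⟩ := exists_rat_gt (max R₀ 0)
  have hcoord : ∀ z ∈ closure s.domain, ∀ l, |z l| ≤ Rq := fun z hz l => by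
    have h1 := norm_le_pi_norm z l
    rw [Real.norm_eq_abs] at h1
    exact h1.trans (((hR₀ z hz).trans (le_max_left _ _)).trans hRq.le)
  have hRq0 : (0 : ℝ) ≤ Rq := ((le_max_right _ _).trans hRq.le)
  set N₁ : ℕ := ⌊2 * (Rq : ℝ) / hq⌋₊ + 3 with hN₁
  set gf : Fin (2 + 1) × Fin N₁ → (Fin (2 + 1) → ℚ) × ℚ := fun li =>
    (Pi.single li.1 1, Rq - ((li.2 : ℕ) : ℚ) * hq) with hgf
  set S : Finset ((Fin (2 + 1) → ℚ) × ℚ) := Finset.univ.image gf with hS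
  have hS0 : (0 : (Fin (2 + 1) → ℚ) × ℚ) ∉ S := by
    intro h0
    obtain ⟨li, -, hli⟩ := Finset.mem_image.1 h0
    have := congr_arg (fun c : (Fin (2 + 1) → ℚ) × ℚ => c.1 li.1) hli
    simp [hgf] at this
  -- dissect
  obtain ⟨c, hc, hrel⟩ := SepHigh.cuts L e p a lo hi S hS0 m' M s hbd hdom hint
  suffices hpieces : ∀ w ∈ SepHigh.Pieces (2 + 1) 0 m L e p a lo hi S m' M,
      ∃ c' ∈ AddSubgroup.closure (GGset 2 1 0), w - c' ∈ KZ.relations by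
    obtain ⟨c', hc', hcc⟩ := SepTwoZero.closure_transfer' hpieces c hc
    refine ⟨c', hc', ?_⟩
    have := add_mem hrel hcc
    rwa [sub_add_sub_cancel] at this
  rintro w ⟨m₁, M₁, s₁, hold, hnew, hbd₁, hdom₁, hint₁, rfl⟩
  have hsub : s₁.domain ⊆ s.domain := by
    rw [hdom₁, hdom]
    exact SepHigh.piece_subset M M₁ lo hi hold
  have hcl : closure s₁.domain ⊆ closure s.domain := closure_mono hsub
  refine piece hHI₃ s₁ M₁ L e p a lo hi hbd₁ hdom₁ hint₁ hact
    (fun j hα he z hz => hpole j hα he z (hsub hz))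
    (fun j j' hα hα' he he' hne => by
      obtain ⟨C, hC⟩ := hrat j j' hα hα' he he' hne
      exact ⟨C, fun z hz => hC z (hsub hz)⟩)
    K₀ (hcl.trans hK₀) hthin fun X X' hX hX' hXs hX's => ?_
  -- two special points in the closed sub-cell coincide
  by_contra hne
  have hd : δ ≤ dist X X' := hδsep X X' hXs hX's hne
  obtain ⟨l, hl⟩ : ∃ l, (hq : ℝ) < |X l - X' l| := by
    by_contra hall
    push Not at hall
    have : dist X X' ≤ hq := (dist_pi_le_iff hhq0'.le).2 fun l => by
      rw [Real.dist_eq]; exact hall l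
    linarith
  -- the sign of a grid form between the two points is constant on the sub-cell
  have hsign : ∀ i : Fin N₁, (∀ z ∈ closure s₁.domain,
      0 ≤ z (Fin.castAdd 0 l) + ((Rq - ((i : ℕ) : ℚ) * hq : ℚ) : ℝ)) ∨
      (∀ z ∈ closure s₁.domain, z (Fin.castAdd 0 l) + ((Rq - ((i : ℕ) : ℚ) * hq : ℚ) : ℝ) ≤ 0) := by
    intro i
    have hg : gf (l, i) ∈ S := Finset.mem_image_of_mem gf (Finset.mem_univ _)
    have hps := SepHigh.piece_sign (k := 0) M₁ lo hi (gf (l, i)) (hnew _ hg)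
    rw [← hdom₁] at hps
    have hcont : Continuous fun z : Fin (2 + 1 + 0) → ℝ =>
        z (Fin.castAdd 0 l) + ((Rq - ((i : ℕ) : ℚ) * hq : ℚ) : ℝ) := by fun_prop
    rcases hps with hpos | hneg
    · refine Or.inl (nonneg_on_closure hcont fun z hz => ?_)
      have := hpos z hz
      rwa [hgf, grid_form_val] at this
    · refine Or.inr fun z hz => ?_
      have h1 := nonneg_on_closure (f := fun z : Fin (2 + 1 + 0) → ℝ =>
        -(z (Fin.castAdd 0 l) + ((Rq - ((i : ℕ) : ℚ) * hq : ℚ) : ℝ))) (by fun_prop) (fun z hz => by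
          have := hneg z hz
          rw [hgf, grid_form_val] at this
          linarith) z hz
      linarith
  -- a grid plane strictly between the two points
  have key : ∀ Y Y' : Fin (2 + 1 + 0) → ℝ, Y ∈ closure s₁.domain → Y' ∈ closure s₁.domain →
      Y l + hq < Y' l → False := by
    intro Y Y' hY hY' hlt
    have hYR : -(Rq : ℝ) ≤ Y l := (abs_le.1 (hcoord Y (hcl hY) l)).1
    have hYR2 : Y l ≤ Rq := (abs_le.1 (hcoord Y (hcl hY) l)).2
    obtain ⟨i, hi1, hi2, hi3⟩ := exists_grid_btwn hhq0' hYR hlt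
    have hiN : i < N₁ := by
      have h1 : (i : ℝ) < 2 * (Rq : ℝ) / hq + 2 := by
        have h2 : (Y l + Rq) / hq ≤ 2 * Rq / hq := by
          rw [div_le_div_iff_of_pos_right hhq0']; linarith
        linarith
      have h3 : (i : ℝ) < (⌊2 * (Rq : ℝ) / hq⌋₊ : ℝ) + 3 := by
        have := Nat.lt_floor_add_one (2 * (Rq : ℝ) / hq)
        have h4 : (0 : ℝ) ≤ 2 * (Rq : ℝ) / hq := by positivity
        linarith [Nat.floor_le h4]
      rw [hN₁]
      exact_mod_cast h3
    have hlY : Y l = Y (Fin.castAdd 0 l) := rfl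
    have hlY' : Y' l = Y' (Fin.castAdd 0 l) := rfl
    have hcast : ((Rq - (((⟨i, hiN⟩ : Fin N₁) : ℕ) : ℚ) * hq : ℚ) : ℝ) = (Rq : ℝ) - (i : ℝ) * hq := by
      push_cast; ring
    rcases hsign ⟨i, hiN⟩ with hpos | hneg
    · have := hpos Y hY
      rw [hcast, ← hlY] at this
      linarith
    · have := hneg Y' hY'
      rw [hcast, ← hlY'] at this
      linarith
  rcases lt_or_gt_of_ne (show X l ≠ X' l from fun h => by rw [h, sub_self, abs_zero] at hl; linarith)
    with hlt | hlt
  · refine key X X' hX hX' ?_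
    rw [abs_of_neg (by linarith)] at hl; linarith
  · refine key X' X hX' hX ?_
    rw [abs_of_pos (by linarith)] at hl; linarith

end SepThree

open SepThree in
/-- **A grid point strictly between two reals more than one mesh apart** (registered sub-goal
of `stub_separateThreeZero`, part `Grid`; the separation step of `SepThree.grid`). -/
theorem separateThree_grid_btwn (u v R h : ℝ) (hh : 0 < h) (hu : -R ≤ u) (huv : u + h < v) : ∃ i : ℕ, u < -R + i * h ∧ -R + i * h < v ∧ (i : ℝ) ≤ (u + R) / h + 1 :=
  exists_grid_btwn hh hu huv

end Summit.KontsevichZagierPeriods.ArrangementNormalForm.JanusBands
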